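import Summits.BirchSwinnertonDyer.Rank1Residual.Additive.ChiBranchLowerInput
import Summits.BirchSwinnertonDyer.Rank1Residual.Additive.ChiBranchConstantTermOdd
import HarnessLib

/-!
# The LOWER half at an additive prime, semistable-twist locus: the ODD Λ-adic branch input
# (`p ≡ 3 (mod 4)`, `p = 3` included) and the sanity lemma "both directions ⟹ `char_Λ X = (ϖ·L_br)`"
# (cell `b2b-bsdres`, team n1011, seat p07, row T-N10-low step (iv) = merged T-c2; sequel of `ChiBranchLowerInput.lean`)

HONEST FRAMING (cell `b2b-bsdres`, run/shared/lean/b2b/bsd-rank1-residual/, verbatim in every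
file): the goal of the cell is to DELETE the COMBINATION-SHAPED residual classes of the
Birch–Swinnerton-Dyer formula for ALL analytic-rank `≤ 1` elliptic curves over `ℚ` — "full BSD
formula for every rank `≤ 1` curve in class `C`" assembled STRICTLY from published theorems — so
that the rank-`≤ 1` remainder becomes exactly the CONSTRUCTION-SHAPED classes, which are TYPED
(missing-input `Prop`s), NOT attempted. This is not "finishing BSD". Team n1011 (RESIDUAL-MAP §I
N10 / N11; lead ruling R3-2: "p07 adds the p ≡ 3 (mod 4) / minus-period ODD twin — at p = 3 ONLY the
odd case occurs — + the two-line sanity lemma"): prove what is provable now; shrink each hard class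
to its core with data; no claim beyond stated classes. Research route on the CONSTRUCTION-SHAPED
item N10 / the class-level LOWER clause of N11; both stay CONSTRUCTION; nothing is booked; no label
moves. ONE `def` (typed input, NOTHING asserted), its unfolding lemma, and theorems; no named fact.

## What and why

`ChiBranchLowerInput.lean` types the Λ-adic INTEGRAL Skinner–Urban containment on the `χ_p`-branch of
the good ordinary twist for `p ≡ 1 (mod 4)` (`ChiBranchLowerDivisibilityAt`, even branch, plus
period `Ω⁺_f`, `padicLFunctionBranch`). At `p = 3` — the whole class-level LOWER clause of N11 —
`p ≡ 3 (mod 4)` and the branch character `ω^{(p−1)/2} = χ_{−p}` is ODD: the twist is by `−p`, the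
period is `Ω⁻_f` (`ϖ⁻·|Ω⁻(V)| = Ω⁻_f`, `V.imaginaryPeriodRat`, `minusPeriod f`) and the branch is
the MINUS-symbol one, `padicLFunctionMinusBranch f α (p/2)` (tree `PAdicLFunctionMinus`,
Mazur–Tate–Teitelbaum §I.13 with `[r]⁻`). This file:

* `ChiBranchLowerDivisibilityOddAt W p` (TYPED): for every semistable-twist datum
  (`V` GOOD ORDINARY at `p`, `C • V^{(−p)} = W`, newform `f`, `ϖ⁻`, cyclotomic `κ/γ`, dual datum `D`
  of `Sel_{p^∞}(W/ℚ_∞)`) EVERY `g ∈ char_Λ X(W/ℚ_∞)` is a `Λ`-multiple of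
  `ϖ⁻ · L_p⁻(f, α, ω^{(p−1)/2}, T)`: the odd twin of `ChiBranchLowerDivisibilityAt`;
* `chiBranchLowerLeadingTermOddAt_of_divisibilityOdd_of_padicValRat_j_nonneg`: on a potentially good
  `W` it implies the `T = 0` odd input `ChiBranchLowerLeadingTermOddAt W p` (constant term of the
  minus branch `= α⁻¹·∑_{a mod p}(a/p)[a/p]⁻_f`, tree theorem
  `constantCoeff_padicLFunctionMinusBranch_half`; a multiplicative twist datum cannot occur);
* SANITY (lead R3-2 / r2 ROUTE-2 II.4.1): `exists_generator_eq_of_exists_eq_of_forall_exists_mul` —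
  if SOME `g₀ ∈ char_Λ X` maps to `B` under `ι : Λ ↪ ℚ_p⟦T⟧` (the Kato direction, shape of
  additive-p4's `ChiBranchDivisibilityAt`) and EVERY `g ∈ char_Λ X` maps to a `Λ`-multiple of `B` (the
  lower direction), then `char_Λ X = (g₀)` with `ι g₀ = B`: the two directions were typed with the
  SAME normalisation (`ϖ`, unit root, no extra unit); instantiated on the even branch for the
  reducible twin (`charIdeal_eq_span_of_chiBranchDivisibility_of_lower`; the tree has no Λ-adic
  big-image ∃-twin after transport — additive-p2/p4 use the `T = 0` forms there).

NOT in print for any pair; N10 / N11-LOWER stay CONSTRUCTION. References: Mazur–Tate–Teitelbaum 1986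
[MazurTateTeitelbaum1986Invent] §I.13–I.14; Skinner–Urban 2014 [SkinnerUrban2014] Thm. 3.6.4 (shape);
Wuthrich 2014 [Wuthrich2014] Thm. 16 (shape); Greenberg 1999 [GreenbergLNM1716] §5.
-/

noncomputable section

open scoped Classical MatrixGroups ModularForm

open CongruenceSubgroup WeierstrassCurve Literature.NumberTheory.EllipticCurves
  Literature.NumberTheory.EllipticCurves.ModularForms
  Literature.NumberTheory.EllipticCurves.Rank1Residual

namespace Summit.BirchSwinnertonDyer.Rank1Residual.Additive

/-! ### The typed input (LOWER direction, Λ-adic, ODD branch) -/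

/-- **The Skinner–Urban containment on the `χ_{−p}`-branch, Λ-adic and INTEGRAL, ODD branch
(`p ≡ 3 (mod 4)`, `p = 3` included), TYPED.** For the additive curve `E = W` (globally minimal) at `p`:
whenever `W` is `ℚ`-isomorphic to the quadratic twist by `−p = p*` of a globally minimal `V` GOOD
ORDINARY at `p`, `f` is the newform of `V`, `κ`/`γ` the cyclotomic `ℤ_p`-extension of `ℚ` with a
topological generator matching the cyclotomic variable, `D` a Pontryagin-dual datum of
`Sel_{p^∞}(W/ℚ_∞)` and `ϖ⁻·|Ω⁻(V)| = Ω⁻_f`, EVERY `g ∈ char_Λ X(W/ℚ_∞)` is, in `ℚ_p⟦T⟧`, a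
`Λ`-multiple of `ϖ⁻ · L_p⁻(f, α, ω^{(p−1)/2}, T)` (`padicLFunctionMinusBranch f α (p/2)`, the
MINUS-symbol branch, `α = unitRoot V p`). Odd twin of `ChiBranchLowerDivisibilityAt`. A predicate on
`(W, p)`; NOT in print at any additive pair; its universal closure is NOT asserted.
[cite: SkinnerUrban2014, Thm. 3.6.4 (p. 43) (shape only; nothing asserted)]
[cite: MazurTateTeitelbaum1986Invent, §I.13 (shape only; nothing asserted)] -/
def ChiBranchLowerDivisibilityOddAt (W : WeierstrassCurve ℚ) (p : ℕ) [Fact p.Prime] : Prop :=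
  ∀ (V : WeierstrassCurve ℚ) [V.IsElliptic] [V.IsGloballyMinimal]
    {κ : ZpExtension ℚ p} {γ : Field.absoluteGaloisGroup ℚ} {N : ℕ} [NeZero N]
    {f : CuspForm (Gamma0 N) 2},
    p % 4 = 3 →
    (∃ C : VariableChange ℚ, C • V.quadraticTwist (-(p : ℚ)) = W) →
    GoodOrd V p →
    κ.IsCyclotomic → κ.IsTopGenerator γ → IsCyclotomicVariable p γ → IsNewformOf V f →
    ∀ (D : W.SelmerDualData κ γ) (ϖ : ℚ), (ϖ : ℝ) * V.imaginaryPeriodRat = minusPeriod f →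
      ∀ g ∈ D.charIdeal, ∃ h : IwasawaAlgebra p,
        iwasawaToPowerSeries p g =
          iwasawaToPowerSeries p h *
            (PowerSeries.C ((ϖ : ℚ) : ℚ_[p]) *
              padicLFunctionMinusBranch f (unitRoot V p : ℚ_[p]) (p / 2))

/-- Unfolding lemma for `ChiBranchLowerDivisibilityOddAt` (to apply the predicate as a function). -/
theorem chiBranchLowerDivisibilityOddAt_iff (W : WeierstrassCurve ℚ) (p : ℕ) [Fact p.Prime] :
    ChiBranchLowerDivisibilityOddAt W p ↔
      ∀ (V : WeierstrassCurve ℚ) [V.IsElliptic] [V.IsGloballyMinimal]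
        {κ : ZpExtension ℚ p} {γ : Field.absoluteGaloisGroup ℚ} {N : ℕ} [NeZero N]
        {f : CuspForm (Gamma0 N) 2},
        p % 4 = 3 →
        (∃ C : VariableChange ℚ, C • V.quadraticTwist (-(p : ℚ)) = W) →
        GoodOrd V p →
        κ.IsCyclotomic → κ.IsTopGenerator γ → IsCyclotomicVariable p γ → IsNewformOf V f →
        ∀ (D : W.SelmerDualData κ γ) (ϖ : ℚ), (ϖ : ℝ) * V.imaginaryPeriodRat = minusPeriod f →
          ∀ g ∈ D.charIdeal, ∃ h : IwasawaAlgebra p,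
            iwasawaToPowerSeries p g =
              iwasawaToPowerSeries p h *
                (PowerSeries.C ((ϖ : ℚ) : ℚ_[p]) *
                  padicLFunctionMinusBranch f (unitRoot V p : ℚ_[p]) (p / 2)) :=
  Iff.rfl

/-! ### The odd Λ-adic input implies the odd `T = 0` input on a potentially good curve -/

variable (p : ℕ) [hp : Fact p.Prime]

/-- **Constant terms, minus branch**: `ι g = ι h · (ϖ⁻ · L_p⁻(f, α, ω^{(p−1)/2}, T))` gives
`g(0) = (h(0)·α⁻¹) · ϖ⁻ · ∑_{a mod p}(a/p)[a/p]⁻_f` with `h(0)·α⁻¹ ∈ ℤ_p` (good ordinary `V`, `p`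
odd): the minus-branch constant term is `α⁻¹·∑(a/p)[a/p]⁻_f` (tree theorem
`constantCoeff_padicLFunctionMinusBranch_half`) and `α = unitRoot V p ∈ ℤ_p^×`.
[cite: MazurTateTeitelbaum1986Invent, §I.14] -/
theorem exists_padicInt_constantCoeff_eq_of_iwasawaToPowerSeries_eq_mul_minusBranch (hp2 : p ≠ 2)
    {N : ℕ} [NeZero N] {f : CuspForm (Gamma0 N) 2} (V : WeierstrassCurve ℚ) [V.IsElliptic]
    [V.IsGloballyMinimal] (hord : IsOrdinaryAt V p) (hf : IsNewformOf V f)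
    {g h : IwasawaAlgebra p} {ϖ : ℚ}
    (hg : iwasawaToPowerSeries p g =
      iwasawaToPowerSeries p h *
        (PowerSeries.C ((ϖ : ℚ) : ℚ_[p]) * padicLFunctionMinusBranch f (unitRoot V p : ℚ_[p]) (p / 2))) :
    ∃ h₀ : ℤ_[p], ((PowerSeries.constantCoeff g : ℤ_[p]) : ℚ_[p]) =
      (h₀ : ℚ_[p]) * (ϖ : ℚ_[p]) * (legendreMinusSymbolSum f p : ℚ_[p]) := by
  obtain ⟨-, hunit⟩ := unitRoot_spec_holds V p hord
  set u : ℤ_[p]ˣ := hunit.unit with hu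
  have hcoe : ((u : ℤ_[p]) : ℚ_[p]) = (unitRoot V p : ℚ_[p]) := by rw [hu, IsUnit.unit_spec]
  have hinv : (((u⁻¹ : ℤ_[p]ˣ) : ℤ_[p]) : ℚ_[p]) = (unitRoot V p : ℚ_[p])⁻¹ := by
    rw [← hcoe]
    refine eq_inv_of_mul_eq_one_left ?_
    rw [← PadicInt.coe_mul, Units.inv_mul, PadicInt.coe_one]
  refine ⟨PowerSeries.constantCoeff h * ((u⁻¹ : ℤ_[p]ˣ) : ℤ_[p]), ?_⟩
  have h0 := congrArg PowerSeries.constantCoeff hg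
  rw [map_mul, map_mul, PowerSeries.constantCoeff_C,
    constantCoeff_padicLFunctionMinusBranch_half p hp2 V hord hf,
    constantCoeff_iwasawaToPowerSeries, constantCoeff_iwasawaToPowerSeries] at h0
  rw [h0, PadicInt.coe_mul, hinv]
  ring

/-- **On a potentially GOOD additive curve the odd Λ-adic LOWER input implies the odd `T = 0` LOWER
input**: `ChiBranchLowerDivisibilityOddAt W p → ChiBranchLowerLeadingTermOddAt W p` when
`0 ≤ ord_p j(W)` (a multiplicative twist datum cannot occur: `ord_p j(W) = ord_p j(V) < 0` for it).
[cite: MazurTateTeitelbaum1986Invent, §I.14] -/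
theorem chiBranchLowerLeadingTermOddAt_of_divisibilityOdd_of_padicValRat_j_nonneg
    (W : WeierstrassCurve ℚ) [W.IsElliptic] (hj : 0 ≤ padicValRat p W.j)
    (hBC : ChiBranchLowerDivisibilityOddAt W p) : ChiBranchLowerLeadingTermOddAt W p := by
  intro V _ _ κ γ N _ f hp4 hVW hV hκ hγ hγ' hf D ϖ hϖ g hgmem
  have hp2 : p ≠ 2 := by omega
  rcases hV with hord | hmult
  · obtain ⟨h, hgh⟩ := hBC V hp4 hVW hord hκ hγ hγ' hf D ϖ hϖ g hgmem
    exact exists_padicInt_constantCoeff_eq_of_iwasawaToPowerSeries_eq_mul_minusBranch p hp2 V hord hf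
      hgh
  · exfalso
    have hp0 : (-(p : ℚ)) ≠ 0 := neg_ne_zero.mpr (by exact_mod_cast hp.out.ne_zero)
    obtain ⟨C, hC⟩ := hVW
    haveI := V.isElliptic_quadraticTwist (d := (-(p : ℚ))) hp0
    have hjV : W.j = V.j := by
      subst hC
      rw [variableChange_j, V.j_quadraticTwist hp0]
    have hneg := EisensteinPrimes.padicValRat_j_neg_of_mult V p hmult
    rw [← hjV] at hneg
    exact absurd hj (not_le.mpr hneg)

/-! ### Sanity: the Kato direction and the lower direction together force `char_Λ X = (ϖ·L_br)` -/

omit hp in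
/-- **Sanity lemma (generic).** Let `I` be an ideal of `Λ = ℤ_p⟦T⟧` and `B ∈ ℚ_p⟦T⟧`. If SOME
`g₀ ∈ I` has `ι g₀ = B` (`ι : Λ ↪ ℚ_p⟦T⟧`) and EVERY `g ∈ I` has `ι g = ι h · B` for some `h ∈ Λ`,
then `I = (g₀)`: every `g` is `h · g₀` by injectivity of `ι`. (With `I = char_Λ X(W/ℚ_∞)` and
`B = ϖ·L_p(f, α, ω^{(p−1)/2}, T)`: the upper (Kato) and lower (Skinner–Urban) typed directions were
stated with the SAME normalisation — no unit, no `ℓ_p`, no period mismatch can hide between them.) -/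
theorem exists_generator_eq_of_exists_eq_of_forall_exists_mul [Fact p.Prime]
    {I : Ideal (IwasawaAlgebra p)} {B : PowerSeries ℚ_[p]}
    (hupper : ∃ g₀ ∈ I, iwasawaToPowerSeries p g₀ = B)
    (hlower : ∀ g ∈ I, ∃ h : IwasawaAlgebra p, iwasawaToPowerSeries p g = iwasawaToPowerSeries p h * B) :
    ∃ g₀ ∈ I, I = Ideal.span {g₀} ∧ iwasawaToPowerSeries p g₀ = B := by
  obtain ⟨g₀, hg₀, hB⟩ := hupper
  refine ⟨g₀, hg₀, le_antisymm ?_ ((Ideal.span_singleton_le_iff_mem _).mpr hg₀), hB⟩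
  intro g hg
  obtain ⟨h, hgh⟩ := hlower g hg
  rw [← hB, ← map_mul] at hgh
  have hg' : g = h * g₀ := iwasawaToPowerSeries_injective p hgh
  rw [hg']
  exact Ideal.mul_mem_left _ h (Ideal.mem_span_singleton_self g₀)

/-- **Sanity on the even branch, reducible twin** (`p ≡ 1 (mod 4)`, good ordinary twist, `E[p]`
reducible): additive-p4's Kato/Wuthrich-direction input `ChiBranchDivisibilityAt W p` (SOME
`g ∈ char_Λ X(W/ℚ_∞)` with `ι g = ϖ·L_p(f, α, ω^{(p−1)/2}, T)`) and the lower-direction input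
`ChiBranchLowerDivisibilityAt W p` together give, for every datum,
`char_Λ X(W/ℚ_∞) = (g₀)` with `ι g₀ = ϖ·L_p(f, α, ω^{(p−1)/2}, T)` — the Iwasawa main conjecture
for `E` over `ℚ_∞` on this locus, in the kernel's two typed halves, with identical normalisations.
Nothing asserted about either input. [cite: Wuthrich2014, Thm. 16 (p. 397) (shape)]
[cite: SkinnerUrban2014, Thm. 3.6.4 (p. 43) (shape)] -/
theorem charIdeal_eq_span_of_chiBranchDivisibility_of_lower (W : WeierstrassCurve ℚ)
    (hup : ChiBranchDivisibilityAt W p) (hlow : ChiBranchLowerDivisibilityAt W p)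
    (V : WeierstrassCurve ℚ) [V.IsElliptic] [V.IsGloballyMinimal]
    {κ : ZpExtension ℚ p} {γ : Field.absoluteGaloisGroup ℚ} {N : ℕ} [NeZero N]
    {f : CuspForm (Gamma0 N) 2} (hp4 : p % 4 = 1)
    (hVW : ∃ C : VariableChange ℚ, C • V.quadraticTwist (p : ℚ) = W) (hV : GoodOrd V p) (hred : Red W p)
    (hκ : κ.IsCyclotomic) (hγ : κ.IsTopGenerator γ) (hγ' : IsCyclotomicVariable p γ) (hf : IsNewformOf V f)
    (D : W.SelmerDualData κ γ) (ϖ : ℚ) (hϖ : (ϖ : ℝ) * V.realPeriodRat = plusPeriod f) :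
    ∃ g₀ ∈ D.charIdeal, D.charIdeal = Ideal.span {g₀} ∧
      iwasawaToPowerSeries p g₀ =
        PowerSeries.C ((ϖ : ℚ) : ℚ_[p]) * padicLFunctionBranch f (unitRoot V p : ℚ_[p]) (p / 2) :=
  exists_generator_eq_of_exists_eq_of_forall_exists_mul p
    (hup V hp4 hVW hV hred hκ hγ hγ' hf D ϖ hϖ).2
    (hlow V hp4 hVW hV hκ hγ hγ' hf D ϖ hϖ)

end Summit.BirchSwinnertonDyer.Rank1Residual.Additive

end
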